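import Mathlib
import Summits.Ventures.PercRepro2.V2SP
import Summits.Ventures.PercRepro2.Tail2DCount
import Summits.Ventures.PercRepro2.Tail2DThreePoint
import Summits.Ventures.PercRepro2.Tail2DThreePointComm
import Summits.Ventures.PercRepro2.Tail2DFlowTwo
import Summits.Ventures.PercRepro2.Tail2DTransport

/-!
# The transport step on the whole wide family `P(e²) ∧ P(e^D)`, `D ≥ 2` (seat mine-b, cell pub-perc-repro2)

`wbd d = P(e²) ∧ P(e^(d+1))` — a bundle of two and a bundle of `D = d + 1` free edges in series — is
the family of max-flow-2 networks that breaks the level minor of the flow-two step as soon as `D ≥ 4`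
(registry §32.6). Its flow counts are computed here in closed form for every `d` (`wbd_counts`:
`n₀₀ = 2`, `n₁₀ = n₀₁ = D + 2`, `n₂₀ = n₀₂ = 2^D − 1 − D`, `n₁₁ = 2^(D+1) − 4`, from the binomial
counts of the bundle, `bundle_card`), and the nine transport hypotheses of `Tail2DTransport.lean` are
verified for ALL `d ≥ 1` as inequalities in `d` and `2^D` (`wbd_hyps`). Hence every pattern of the M♮
class stays in the class under parallel composition with any member of the family
(`MTailPat.par_wbd`), and every cube `(P(e²) ∧ P(e^D)) ∗ (P(e²) ∧ P(e^D'))` (`D, D' ≥ 2`) has an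
M♮-concave counting tail (`mtail_wbd_par_wbd`) — infinitely many cubes in one theorem, the first
family of the wide regime in the kernel.
-/

namespace Summit.Ventures.PercRepro2.Tail2D

open V2Closure

/-- the bundle of `d + 1` free edges in parallel -/
def bundle : ℕ → V2Closure.SP
  | 0 => .free
  | d + 1 => .par (bundle d) .free

/-- every configuration of the bundle of `d + 1` edges has `r + b = d + 1` -/
lemma bundle_lab (d : ℕ) (y : (bundle d).Conf) : (bundle d).rLab y + (bundle d).bLab y = d + 1 := by
  induction d with
  | zero =>
    change Bool at y
    cases y <;> simp [bundle, SP.rLab, SP.bLab]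
  | succ d ih =>
    obtain ⟨y, c⟩ := y
    have := ih y
    cases c <;> simp [bundle, SP.rLab, SP.bLab, parR, parB] at * <;> omega

/-- the number of configurations of the bundle with red flow `r` is the binomial coefficient -/
lemma bundle_card (d : ℕ) (r : ℕ) :
    (Finset.univ.filter (fun y : (bundle d).Conf => (bundle d).rLab y = r)).card = (d + 1).choose r := by
  induction d generalizing r with
  | zero =>
    rcases r with _ | _ | r
    · decide
    · decide
    · rw [Nat.choose_eq_zero_of_lt (by omega)]
      rw [Finset.card_eq_zero, Finset.filter_eq_empty_iff]
      intro y _; change Bool at y; cases y <;> simp [bundle, SP.rLab]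
  | succ d ih =>
    have e : (Finset.univ.filter (fun y : (bundle (d + 1)).Conf => (bundle (d + 1)).rLab y = r)).card
        = (Finset.univ.filter (fun y : (bundle d).Conf => (bundle d).rLab y = r)).card
          + (Finset.univ.filter (fun y : (bundle d).Conf => (bundle d).rLab y + 1 = r)).card := by
      rw [Finset.card_filter, Finset.card_filter, Finset.card_filter]
      change (∑ p : (bundle d).Conf × Bool, if (bundle d).rLab p.1 + (if p.2 then 0 else 1) = r then 1 else 0) = _
      rw [Fintype.sum_prod_type, Finset.sum_comm]
      rw [Fintype.sum_bool]
      simp only [Bool.false_eq_true, ↓reduceIte, add_zero]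
    rw [e, ih r]
    rcases r with _ | r
    · simp
    · have : (Finset.univ.filter (fun y : (bundle d).Conf => (bundle d).rLab y + 1 = r + 1)).card
          = (Finset.univ.filter (fun y : (bundle d).Conf => (bundle d).rLab y = r)).card := by
        congr 1; ext y; simp
      rw [this, ih r, show d + 1 + 1 = d + 2 from rfl, Nat.choose_succ_succ (d + 1) r]; ring

/-- a sum over the configurations of the bundle of a function of the red flow is a binomial sum -/
lemma bundle_sum (d : ℕ) (f : ℕ → ℕ) :
    (∑ y : (bundle d).Conf, f ((bundle d).rLab y)) = ∑ r ∈ Finset.range (d + 2), f r * (d + 1).choose r := by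
  rw [← Finset.sum_fiberwise_of_maps_to (s := Finset.univ) (t := Finset.range (d + 2))
    (g := fun y => (bundle d).rLab y) (fun y _ => by simp; have := bundle_lab d y; omega)]
  refine Finset.sum_congr rfl (fun r _ => ?_)
  rw [← bundle_card d r, Finset.card_eq_sum_ones, Finset.mul_sum]
  refine Finset.sum_congr rfl (fun y hy => ?_)
  simp only [Finset.mem_filter] at hy
  rw [hy.2, mul_one]

/-- the all-red configuration of the bundle -/
def bundle.allRed : ∀ d : ℕ, (bundle d).Conf
  | 0 => false
  | d + 1 => (bundle.allRed d, false)

/-- the all-blue configuration of the bundle -/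
def bundle.allBlue : ∀ d : ℕ, (bundle d).Conf
  | 0 => true
  | d + 1 => (bundle.allBlue d, true)

/-- the all-red configuration has flows `(d + 1, 0)` -/
lemma bundle.allRed_lab (d : ℕ) : (bundle d).rLab (bundle.allRed d) = d + 1 ∧ (bundle d).bLab (bundle.allRed d) = 0 := by
  induction d with
  | zero => simp [bundle, bundle.allRed, SP.rLab, SP.bLab]
  | succ d ih => simp [bundle, bundle.allRed, SP.rLab, SP.bLab, parR, parB, ih.1, ih.2]

/-- the all-blue configuration has flows `(0, d + 1)` -/
lemma bundle.allBlue_lab (d : ℕ) : (bundle d).rLab (bundle.allBlue d) = 0 ∧ (bundle d).bLab (bundle.allBlue d) = d + 1 := by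
  induction d with
  | zero => simp [bundle, bundle.allBlue, SP.rLab, SP.bLab]
  | succ d ih => simp [bundle, bundle.allBlue, SP.rLab, SP.bLab, parR, parB, ih.1, ih.2]

/-- the bundle of two and the bundle of `d + 1` edges in series: the wide six-point family -/
def wbd (d : ℕ) : V2Closure.SP := .ser (.par .free .free) (bundle d)

/-- the flow counts of `wbd d` as binomial sums over the red flow of the wide bundle -/
lemma wbd_flowCount (d : ℕ) (i j : ℕ) :
    flowCount (wbd d) i j
      = ∑ r ∈ Finset.range (d + 2),
          ((if min 2 r = i ∧ min 0 (d + 1 - r) = j then 1 else 0)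
            + 2 * (if min 1 r = i ∧ min 1 (d + 1 - r) = j then 1 else 0)
            + (if min 0 r = i ∧ min 2 (d + 1 - r) = j then 1 else 0)) * (d + 1).choose r := by
  unfold flowCount wbd
  rw [Finset.card_filter]
  change (∑ p : (Bool × Bool) × (bundle d).Conf, if min ((if p.1.1 then 0 else 1) + (if p.1.2 then 0 else 1)) ((bundle d).rLab p.2) = i
      ∧ min ((if p.1.1 then 1 else 0) + (if p.1.2 then 1 else 0)) ((bundle d).bLab p.2) = j then 1 else 0) = _
  rw [Fintype.sum_prod_type, Fintype.sum_prod_type, Fintype.sum_bool, Fintype.sum_bool, Fintype.sum_bool]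
  simp only [Bool.false_eq_true, ↓reduceIte, add_zero, zero_add]
  have hb : ∀ y : (bundle d).Conf, (bundle d).bLab y = d + 1 - (bundle d).rLab y := fun y => by
    have := bundle_lab d y; omega
  simp only [hb]
  rw [← Finset.sum_add_distrib, ← Finset.sum_add_distrib, ← Finset.sum_add_distrib]
  rw [← bundle_sum d (fun r => (if min 2 r = i ∧ min 0 (d + 1 - r) = j then 1 else 0)
            + 2 * (if min 1 r = i ∧ min 1 (d + 1 - r) = j then 1 else 0)
            + (if min 0 r = i ∧ min 2 (d + 1 - r) = j then 1 else 0))]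
  refine Finset.sum_congr rfl (fun y _ => ?_)
  norm_num
  split_ifs <;> omega

/-- a binomial sum with the terms `r = 0` and `r = 1` split off -/
lemma sum_choose_ge_two (D : ℕ) (hD : 1 ≤ D) :
    (∑ r ∈ Finset.range (D + 1), if 2 ≤ r then D.choose r else 0) + 1 + D = 2 ^ D := by
  have h := Nat.sum_range_choose D
  have e : ∀ r ∈ Finset.range (D + 1), D.choose r
      = (if 2 ≤ r then D.choose r else 0) + ((if r = 0 then D.choose r else 0) + (if r = 1 then D.choose r else 0)) := by
    intro r _; split_ifs <;> omega
  rw [Finset.sum_congr rfl e, Finset.sum_add_distrib, Finset.sum_add_distrib, Finset.sum_ite_eq', Finset.sum_ite_eq'] at h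
  simp only [Finset.mem_range, show 0 < D + 1 by omega, show 1 < D + 1 by omega, if_true, Nat.choose_zero_right,
    Nat.choose_one_right] at h
  omega

/-- a binomial sum with the terms `r = D` and `r = D − 1` split off -/
lemma sum_choose_le_sub_two (D : ℕ) (hD : 1 ≤ D) :
    (∑ r ∈ Finset.range (D + 1), if r + 2 ≤ D then D.choose r else 0) + 1 + D = 2 ^ D := by
  have h := Nat.sum_range_choose D
  have e : ∀ r ∈ Finset.range (D + 1), D.choose r
      = (if r + 2 ≤ D then D.choose r else 0) + ((if r = D then D.choose r else 0) + (if r = D - 1 then D.choose r else 0)) := by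
    intro r hr; simp only [Finset.mem_range] at hr; split_ifs <;> omega
  rw [Finset.sum_congr rfl e, Finset.sum_add_distrib, Finset.sum_add_distrib, Finset.sum_ite_eq', Finset.sum_ite_eq'] at h
  have h1 : D.choose (D - 1) = D := by
    obtain ⟨k, rfl⟩ : ∃ k, D = k + 1 := ⟨D - 1, by omega⟩
    simp
  simp only [Finset.mem_range, show D < D + 1 by omega, show D - 1 < D + 1 by omega, if_true, Nat.choose_self, h1] at h
  omega

/-- a binomial sum with both end terms split off -/
lemma sum_choose_mid (D : ℕ) (hD : 1 ≤ D) :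
    (∑ r ∈ Finset.range (D + 1), if 1 ≤ r ∧ r + 1 ≤ D then D.choose r else 0) + 2 = 2 ^ D := by
  have h := Nat.sum_range_choose D
  have e : ∀ r ∈ Finset.range (D + 1), D.choose r
      = (if 1 ≤ r ∧ r + 1 ≤ D then D.choose r else 0) + ((if r = 0 then D.choose r else 0) + (if r = D then D.choose r else 0)) := by
    intro r hr; simp only [Finset.mem_range] at hr; split_ifs <;> omega
  rw [Finset.sum_congr rfl e, Finset.sum_add_distrib, Finset.sum_add_distrib, Finset.sum_ite_eq', Finset.sum_ite_eq'] at h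
  simp only [Finset.mem_range, show 0 < D + 1 by omega, show D < D + 1 by omega, if_true, Nat.choose_zero_right,
    Nat.choose_self] at h
  omega

/-- the six flow counts of `wbd d` (`D = d + 1` edges in the wide bundle): `n₀₀ = 2`, `n₁₀ = n₀₁ = D + 2`,
`n₂₀ = n₀₂ = 2^D − 1 − D`, `n₁₁ = 2^(D+1) − 4` -/
theorem wbd_counts (d : ℕ) :
    flowCount (wbd d) 0 0 = 2 ∧ flowCount (wbd d) 1 0 = d + 3 ∧ flowCount (wbd d) 0 1 = d + 3 ∧
    flowCount (wbd d) 2 0 + (d + 2) = 2 ^ (d + 1) ∧ flowCount (wbd d) 0 2 + (d + 2) = 2 ^ (d + 1) ∧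
    flowCount (wbd d) 1 1 + 4 = 2 ^ (d + 2) := by
  refine ⟨?_, ?_, ?_, ?_, ?_, ?_⟩
  · rw [wbd_flowCount]
    have e : ∀ r ∈ Finset.range (d + 2),
        ((if min 2 r = 0 ∧ min 0 (d + 1 - r) = 0 then 1 else 0) + 2 * (if min 1 r = 0 ∧ min 1 (d + 1 - r) = 0 then 1 else 0)
          + (if min 0 r = 0 ∧ min 2 (d + 1 - r) = 0 then 1 else 0)) * (d + 1).choose r
        = (if r = 0 then (d + 1).choose r else 0) + (if r = d + 1 then (d + 1).choose r else 0) := by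
      intro r hr; simp only [Finset.mem_range] at hr; split_ifs <;> omega
    rw [Finset.sum_congr rfl e, Finset.sum_add_distrib, Finset.sum_ite_eq', Finset.sum_ite_eq']
    simp only [Finset.mem_range, show 0 < d + 2 by omega, show d + 1 < d + 2 by omega, if_true, Nat.choose_zero_right,
      Nat.choose_self]
  · rw [wbd_flowCount]
    have e : ∀ r ∈ Finset.range (d + 2),
        ((if min 2 r = 1 ∧ min 0 (d + 1 - r) = 0 then 1 else 0) + 2 * (if min 1 r = 1 ∧ min 1 (d + 1 - r) = 0 then 1 else 0)
          + (if min 0 r = 1 ∧ min 2 (d + 1 - r) = 0 then 1 else 0)) * (d + 1).choose r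
        = (if r = 1 then (d + 1).choose r else 0) + 2 * (if r = d + 1 then (d + 1).choose r else 0) := by
      intro r hr; simp only [Finset.mem_range] at hr; split_ifs <;> omega
    rw [Finset.sum_congr rfl e, Finset.sum_add_distrib, ← Finset.mul_sum, Finset.sum_ite_eq', Finset.sum_ite_eq']
    simp only [Finset.mem_range, show 1 < d + 2 by omega, show d + 1 < d + 2 by omega, if_true, Nat.choose_one_right,
      Nat.choose_self]
    ring
  · rw [wbd_flowCount]
    have e : ∀ r ∈ Finset.range (d + 2),
        ((if min 2 r = 0 ∧ min 0 (d + 1 - r) = 1 then 1 else 0) + 2 * (if min 1 r = 0 ∧ min 1 (d + 1 - r) = 1 then 1 else 0)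
          + (if min 0 r = 0 ∧ min 2 (d + 1 - r) = 1 then 1 else 0)) * (d + 1).choose r
        = 2 * (if r = 0 then (d + 1).choose r else 0) + (if r = d then (d + 1).choose r else 0) := by
      intro r hr; simp only [Finset.mem_range] at hr; split_ifs <;> omega
    rw [Finset.sum_congr rfl e, Finset.sum_add_distrib, ← Finset.mul_sum, Finset.sum_ite_eq', Finset.sum_ite_eq']
    simp only [Finset.mem_range, show 0 < d + 2 by omega, show d < d + 2 by omega, if_true, Nat.choose_zero_right,
      Nat.choose_succ_self_right]
    ring
  · rw [wbd_flowCount]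
    have e : ∀ r ∈ Finset.range (d + 2),
        ((if min 2 r = 2 ∧ min 0 (d + 1 - r) = 0 then 1 else 0) + 2 * (if min 1 r = 2 ∧ min 1 (d + 1 - r) = 0 then 1 else 0)
          + (if min 0 r = 2 ∧ min 2 (d + 1 - r) = 0 then 1 else 0)) * (d + 1).choose r
        = (if 2 ≤ r then (d + 1).choose r else 0) := by
      intro r hr; simp only [Finset.mem_range] at hr; split_ifs <;> omega
    rw [Finset.sum_congr rfl e]
    have := sum_choose_ge_two (d + 1) (by omega)
    rw [show d + 1 + 1 = d + 2 from rfl] at this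
    omega
  · rw [wbd_flowCount]
    have e : ∀ r ∈ Finset.range (d + 2),
        ((if min 2 r = 0 ∧ min 0 (d + 1 - r) = 2 then 1 else 0) + 2 * (if min 1 r = 0 ∧ min 1 (d + 1 - r) = 2 then 1 else 0)
          + (if min 0 r = 0 ∧ min 2 (d + 1 - r) = 2 then 1 else 0)) * (d + 1).choose r
        = (if r + 2 ≤ d + 1 then (d + 1).choose r else 0) := by
      intro r hr; simp only [Finset.mem_range] at hr; split_ifs <;> omega
    rw [Finset.sum_congr rfl e]
    have := sum_choose_le_sub_two (d + 1) (by omega)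
    rw [show d + 1 + 1 = d + 2 from rfl] at this
    omega
  · rw [wbd_flowCount]
    have e : ∀ r ∈ Finset.range (d + 2),
        ((if min 2 r = 1 ∧ min 0 (d + 1 - r) = 1 then 1 else 0) + 2 * (if min 1 r = 1 ∧ min 1 (d + 1 - r) = 1 then 1 else 0)
          + (if min 0 r = 1 ∧ min 2 (d + 1 - r) = 1 then 1 else 0)) * (d + 1).choose r
        = 2 * (if 1 ≤ r ∧ r + 1 ≤ d + 1 then (d + 1).choose r else 0) := by
      intro r hr; simp only [Finset.mem_range] at hr; split_ifs <;> omega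
    rw [Finset.sum_congr rfl e, ← Finset.mul_sum]
    have := sum_choose_mid (d + 1) (by omega)
    rw [show d + 1 + 1 = d + 2 from rfl] at this
    rw [pow_succ 2 (d + 1)]
    omega

/-- `wbd d` has max-flow `≤ 2` -/
theorem wbd_flowLeTwo (d : ℕ) : FlowLeTwo (wbd d) := by
  unfold FlowLeTwo wbd
  rintro ⟨⟨a1, a2⟩, y⟩
  cases a1 <;> cases a2 <;> simp [SP.rLab, SP.bLab, V2Closure.serR, V2Closure.serB, V2Closure.parR, V2Closure.parB] <;> omega

/-- `wbd d` attains the flows `(2,0)`, `(1,1)` and `(0,2)` as soon as the wide bundle has `≥ 2` edges -/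
theorem wbd_top (d : ℕ) (hd : 1 ≤ d) :
    (∃ y : (wbd d).Conf, (wbd d).rLab y = 2 ∧ (wbd d).bLab y = 0)
    ∧ (∃ y : (wbd d).Conf, (wbd d).rLab y = 1 ∧ (wbd d).bLab y = 1)
    ∧ (∃ y : (wbd d).Conf, (wbd d).rLab y = 0 ∧ (wbd d).bLab y = 2) := by
  obtain ⟨k, rfl⟩ : ∃ k, d = k + 1 := ⟨d - 1, by omega⟩
  have hr := bundle.allRed_lab (k + 1); have hb := bundle.allBlue_lab (k + 1); have hr' := bundle.allRed_lab k
  refine ⟨⟨((false, false), bundle.allRed (k + 1)), ?_⟩, ⟨((false, true), (bundle.allRed k, true)), ?_⟩,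
    ⟨((true, true), bundle.allBlue (k + 1)), ?_⟩⟩
  · simp only [wbd, SP.rLab, SP.bLab, serR, serB, parR, parB, hr.1, hr.2]; simp
  · simp only [wbd, bundle, SP.rLab, SP.bLab, serR, serB, parR, parB, hr'.1, hr'.2]; simp
  · simp only [wbd, SP.rLab, SP.bLab, serR, serB, parR, parB, hb.1, hb.2]; simp

/-- the nine transport hypotheses of `Tail2DTransport.lean` hold for `wbd d` for EVERY `d ≥ 1`:
with `x = 2^(d+1) ≥ d + 3` they are polynomial inequalities in `d` and `x` -/
theorem wbd_hyps (d : ℕ) (hd : 1 ≤ d) :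
    flowCount (wbd d) 0 0 * flowCount (wbd d) 2 0 ≤ flowCount (wbd d) 1 0 * flowCount (wbd d) 1 0 + flowCount (wbd d) 1 0 * flowCount (wbd d) 2 0 ∧
    flowCount (wbd d) 0 0 * flowCount (wbd d) 0 2 ≤ flowCount (wbd d) 0 1 * flowCount (wbd d) 0 1 + flowCount (wbd d) 0 1 * flowCount (wbd d) 0 2 ∧
    flowCount (wbd d) 2 0 * flowCount (wbd d) 0 2 ≤ flowCount (wbd d) 1 1 * flowCount (wbd d) 1 1 ∧
    flowCount (wbd d) 2 0 * flowCount (wbd d) 0 1 ≤ flowCount (wbd d) 1 0 * flowCount (wbd d) 1 1 ∧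
    flowCount (wbd d) 0 2 * flowCount (wbd d) 1 0 ≤ flowCount (wbd d) 0 1 * flowCount (wbd d) 1 1 ∧
    flowCount (wbd d) 0 0 * flowCount (wbd d) 2 0 ≤ flowCount (wbd d) 1 0 * flowCount (wbd d) 1 0 + flowCount (wbd d) 1 0 * flowCount (wbd d) 1 1 ∧
    flowCount (wbd d) 0 0 * flowCount (wbd d) 0 2 ≤ flowCount (wbd d) 0 1 * flowCount (wbd d) 0 1 + flowCount (wbd d) 0 1 * flowCount (wbd d) 1 1 ∧
    flowCount (wbd d) 0 0 * flowCount (wbd d) 1 1 ≤ flowCount (wbd d) 1 0 * flowCount (wbd d) 0 1 + flowCount (wbd d) 0 1 * flowCount (wbd d) 2 0 ∧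
    flowCount (wbd d) 0 0 * flowCount (wbd d) 1 1 ≤ flowCount (wbd d) 1 0 * flowCount (wbd d) 0 1 + flowCount (wbd d) 1 0 * flowCount (wbd d) 0 2 := by
  obtain ⟨c00, c10, c01, c20, c02, c11⟩ := wbd_counts d
  have hx : d + 3 ≤ 2 ^ (d + 1) := by
    have h1 : d + 1 ≤ 2 ^ d := Nat.lt_two_pow_self
    rw [pow_succ]; omega
  rw [pow_succ] at c11
  rw [c00, c10, c01]
  set y := flowCount (wbd d) 2 0 with hy
  set y' := flowCount (wbd d) 0 2 with hy'
  set w := flowCount (wbd d) 1 1 with hw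
  have e1 : y' = y := by omega
  have e2 : w = 2 * y + 2 * d := by omega
  rw [e1, e2]
  refine ⟨?_, ?_, ?_, ?_, ?_, ?_, ?_, ?_, ?_⟩ <;> nlinarith [hd, hx, c20]

/-- **parallel composition with `P(e²) ∧ P(e^D)` keeps the M♮ class for every `D ≥ 2`** (either side) -/
theorem MTailPat.par_wbd {s : V2Closure.SP} {L : ℤ} (hs : MTailPat s L) (d : ℕ) (hd : 1 ≤ d) :
    MTailPat (.par s (wbd d)) (L + 2) ∧ MTailPat (.par (wbd d) s) (L + 2) := by
  obtain ⟨h1, h2, h3, h4, h5, h6, h7, h8, h9⟩ := wbd_hyps d hd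
  obtain ⟨t1, t2, t3⟩ := wbd_top d hd
  exact MTailPat.par_flow2' hs (wbd d) (wbd_flowLeTwo d) t1 t2 t3 h1 h2 h3 h4 h5 h6 h7 h8 h9

/-- the bundle is `Good` (iterated bundle-parallel) -/
theorem bundle_good (d : ℕ) : Good (bundle d) (d + 1) := by
  induction d with
  | zero => exact Good.free
  | succ d ih =>
    have := Good.par .free ih flowLeOne_free ⟨false, by decide⟩ ⟨true, by decide⟩
    simpa [bundle, add_assoc] using this

/-- `wbd d` itself is in the class (a series of two bundle-parallel terms) -/
theorem mtail_wbd (d : ℕ) (hd : 1 ≤ d) : MTailPat (wbd d) 2 := by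
  have e1 : Good (.par .free .free) (1 + 1) :=
    Good.par .free Good.free flowLeOne_free ⟨false, by decide⟩ ⟨true, by decide⟩
  have h : Good (wbd d) (min (1 + 1) ((d : ℤ) + 1)) := Good.ser e1 (bundle_good d)
  have hm : min ((1 : ℤ) + 1) ((d : ℤ) + 1) = 2 := by
    have : (1 : ℤ) ≤ d := by exact_mod_cast hd
    omega
  rw [hm] at h
  exact MTailPat.of_good h

/-- **every cube `(P(e²) ∧ P(e^D)) ∗ (P(e²) ∧ P(e^D'))` with `D, D' ≥ 2`** has an M♮-concave counting
tail of level `4` — an infinite family of wide cubes in the kernel -/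
theorem mtail_wbd_par_wbd (d d' : ℕ) (hd : 1 ≤ d) (hd' : 1 ≤ d') : IsMTail (cnt (.par (wbd d) (wbd d'))) 4 := by
  have := (MTailPat.par_wbd (mtail_wbd d hd) d' hd').1
  simpa [MTailPat] using this

end Summit.Ventures.PercRepro2.Tail2D
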